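import Literature.NumberTheory.EllipticCurves.DeligneSerreCompanionAuxiliaryLevelProofs
import Literature.NumberTheory.EllipticCurves.NewformsLevelRaising
import HarnessLib

/-!
# Deligne–Serre companions at an auxiliary prime `ℓ`: DESCENT to level `N` unless Ribet's
# level-raising congruence `a_ℓ(f)² ≡ ℓ^{k₀-2}(ℓ+1)² (mod 𝔪)` holds (proofs only)

Topic `Literature/NumberTheory/EllipticCurves`; namespace
`Literature.NumberTheory.EllipticCurves.ModularForms`.  THEOREMS ONLY (no definition, no named fact).

`DeligneSerreCompanionAuxiliaryLevelProofs.exists_isNewform0_dvd_level_congr_of_multiplier_of_dvd`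
(and `CongruentNewformMultiplierProofs.exists_isNewform0_dvd_level_congr_of_multiplier`) produce,
from a newform `f ∈ S_{k₀}(Γ₀(N))` and a multiplier `G ≡ 1 (mod 𝔪)` on `Γ₀(N')`, `N ∣ N'`, a congruent
newform `g` of weight `k₀ + w` and of SOME level `M ∣ N'` — at the primes of `N'/N` nothing is said,
and at `p = 3` (multiplier `E₂^{(2)}/(1-2)`, `N' = 2N`) the companion may a priori be `2`-new.  This
file decides that question on the Hecke side, with no Galois representation and no geometry
(Katz / Carayol): for an auxiliary PRIME `ℓ ∤ pN` and `N' = Nℓ`,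

* run Deligne–Serre not on `f · G` but on the **`ℓ`-stabilised** old form `(f − β·ι_ℓ f) · G`
  (`α, β` the roots of `X² − a_ℓ(f) X + ℓ^{k₀-1}`, `ι_ℓ f = f(ℓτ)`), whose `q`-expansion
  `cₙ = aₙ(f) − β a_{n/ℓ}(f)` satisfies the level-`Nℓ` Hecke recursions EXACTLY, including
  `c_{ℓn} = α cₙ` — so the form is an eigenvector modulo `𝔪` of the FULL Hecke family at level `Nℓ`,
  `U_ℓ` included, and the Deligne–Serre lift `F` is a genuine `U_ℓ`-eigenform, `U_ℓ F = u F`, `u ≡ α`;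
* the newform `g` behind `F` (`exists_isNewform0_mem_span_of_eigenpacket`: `F` is a combination of the
  old forms `[α_d] g`) has level `M ∣ Nℓ`, and EITHER `ℓ ∤ M`, i.e. **`M ∣ N`**, OR `ℓ ∥ M`, in which case
  `U_ℓ = a_ℓ(g)` on those old forms (`heckeT_eq_smul_of_mem_span_of_dvd`, Diamond–Shurman Prop. 5.6.2)
  and `a_ℓ(g)² = ℓ^{k-2}` (`IsNewform0.coeff_sq_eq_of_exactly_dvd`, Miyake Thm. 4.6.17), so that
  `α² ≡ ℓ^{k-2} ≡ ℓ^{k₀-2}` and, with `α² = a_ℓ(f) α − ℓ^{k₀-1}`,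
  **`a_ℓ(f)² ≡ ℓ^{k₀-2} (ℓ + 1)² (mod 𝔪)`** — Ribet's level-raising congruence (Ribet 1984 / 1990,
  Diamond–Taylor 1994: the condition under which `ρ̄_f` CAN be `ℓ`-new; here only its necessity is
  used, and proved from scratch on `q`-expansions).

Results:

* `exists_isNewform0_eigenform_of_modEigenform` — the Deligne–Serre ∘ Atkin–Lehner–Li pipeline for an
  ABSTRACT mod-`𝔪` eigenform `x ∈ S_k(N', 𝟙)` (`p`-integral coefficients, `a₁(x)` a unit,
  `T_q x ≡ A_q x (mod 𝔪)` coefficientwise for EVERY prime `q`): a newform `g` of level `M ∣ N'`, a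
  non-zero `Γ₀(N')`-eigenform `F` of ALL the `T_q` in the old span of `g`, with eigenvalues
  `u_q ≡ A_q (mod 𝔪)` and `a_q(g) = u_q` for `q ∤ N'` (the tree's pipeline, which forgets `F` and the
  `u_q` at `q ∣ N'`, is the special case used so far);
* `IsNewform0.dvd_or_dvd_of_mem_span_auxPrime` — the `Γ₀(Nℓ)` dichotomy for a `U_ℓ`-eigenform in the
  old span of a newform `g` of level `M ∣ Nℓ` (`ℓ ∤ N`): `M ∣ N` with `u² − a_ℓ(g) u + ℓ^{k-1} = 0`, or
  `ℓ ∥ M` with `u = a_ℓ(g)`, `u² = ℓ^{k-2}` (the non-ordinary twin of the descent in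
  `exists_isNewform0_of_ordinary_pStabilised`);
* `norm_sq_sub_levelRaising_lt_one`, `norm_sub_lt_one_of_oldRelation`, `stabilised_heckeRecursion` —
  the congruence algebra in `ℚ̄_p` and the `q`-expansion recursions of `f − β ι_ℓ f`;
* `exists_isNewform0_dvd_level_congr_of_multiplier_auxPrime` — newform `f ∈ S_{k₀}(Γ₀(N))`, `k₀ ≥ 2`,
  prime `ℓ ∤ N`, `ℓ ≠ p`, multiplier `G ∈ M_w(Γ₁(Nℓ))` (`Γ₀(Nℓ)`-invariant, `≡ 1 (mod 𝔪)`,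
  `(p-1) ∣ w`): a newform `g ∈ S_{k₀+w}(Γ₀(M))`, `M ∣ Nℓ`, congruent to `f` at every prime `q ∤ Nℓ`,
  AND `ℓ ∣ M ⟹ ‖ι⁻¹a_ℓ(f)² − ℓ^{k₀-2}(ℓ+1)²‖ < 1`, AND `ℓ ∤ M ⟹ a_ℓ(g) ≡ a_ℓ(f)` too;
  `exists_isNewform0_dvd_level_congr_of_multiplier_auxPrime_of_norm_eq_one` — hence **`M ∣ N` and
  congruence at every `q ∤ N` as soon as `a_ℓ(f)² ≢ ℓ^{k₀-2}(ℓ+1)² (mod 𝔪)`**;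
* `exists_mazurMultiplier` — Mazur's `E₂^{(M)}/(1 − M)` packaged as a Deligne–Serre multiplier on
  `Γ₁(N')` (object form of the construction in `DeligneSerreCompanionAuxiliaryLevelProofs`);
* `exists_isNewform0_dvd_level_congr_weight_add_two_three_of_auxPrime` — **at `p = 3`: for EVERY
  newform `f ∈ S_{k₀}(Γ₀(N))`, `k₀ ≥ 2`, and every prime `ℓ ∤ 3N` with `ℓ ≡ 2 (mod 3)` and
  `‖ι⁻¹ a_ℓ(f)‖₃ = 1`, a congruent newform of weight `k₀ + 2` and level `M ∣ N`** (Mazur's multiplier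
  `E₂^{(ℓ)}/(1 − ℓ) ≡ 1 (mod 3)`; the congruence class `(ℓ+1)² ≡ 0`).  This removes the residue
  «every prime factor of `N` is `≡ 1 (mod 3)`» of `DeligneSerreCompanionAuxiliaryLevelProofs` for every
  `f` having ONE good prime `ℓ ≡ 2 (mod 3)` with `a_ℓ(f)` a `3`-adic unit (for `ρ̄_{f,3}` with image
  `⊇ SL₂(𝔽₃)` such primes have positive density by Chebotarev — not claimed here; per form it is a
  finite check);
(The same argument runs at `p = 2` with an odd auxiliary prime `ℓ`, `8 ∤ ℓ − 1`; not spelled out here.)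

## References

* P. Deligne, J.-P. Serre, *Formes modulaires de poids 1*, Ann. Sci. ÉNS (4) 7 (1974), 507–530,
  Lemme 6.11. [DeligneSerreASENS1974]
* K. A. Ribet, *Congruence relations between modular forms*, Proc. ICM Warsaw 1983 (PWN, 1984),
  503–514, Thm. 1 and its necessity remark; K. A. Ribet, *Raising the levels of modular
  representations*, Sém. Théor. Nombres Paris 1987–88, Progr. Math. 81 (1990), 259–271. [Ribet1984ICM]
* F. Diamond, J. Shurman, *A First Course in Modular Forms*, GTM 228 (2005), Prop. 5.6.2, §5.7,
  Thm. 5.8.3. [DiamondShurman2005]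
* T. Miyake, *Modular Forms*, Springer (1989; reprint 2006), Thm. 4.6.17. [Miyake2006]
-/

noncomputable section

open scoped MatrixGroups ModularForm
open CongruenceSubgroup UpperHalfPlane

namespace Literature.NumberTheory.EllipticCurves.ModularForms

/-! ### Norm bookkeeping in `ℚ̄_p` (local copies of private helpers of `HidaFamilyMembersProofs`) -/

section Norm

variable {p : ℕ} [Fact p.Prime]

/-- Chaining two congruences modulo `𝔪`. [folklore] -/
private theorem norm_sub_lt_one_trans₃ {x y z : PadicAlgCl p} (h₁ : ‖x - y‖ < 1)
    (h₂ : ‖y - z‖ < 1) : ‖x - z‖ < 1 := by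
  have : x - z = (x - y) + (y - z) := by ring
  rw [this]
  exact (PadicAlgCl.isNonarchimedean p _ _).trans_lt (max_lt h₁ h₂)

/-- Ultrametric inequality for differences. [folklore] -/
private theorem norm_sub_le_max₃ (x y : PadicAlgCl p) : ‖x - y‖ ≤ max ‖x‖ ‖y‖ := by
  have h := PadicAlgCl.isNonarchimedean p x (-y)
  rwa [norm_neg, ← sub_eq_add_neg] at h

/-- An element congruent to an element of norm `1` has norm `1`. [folklore] -/
private theorem norm_eq_one_of_norm_sub_lt_one₃ {x y : PadicAlgCl p} (hy : ‖y‖ = 1)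
    (h : ‖x - y‖ < 1) : ‖x‖ = 1 := by
  apply le_antisymm
  · have h1 : x = (x - y) + y := by ring
    rw [h1]
    exact (PadicAlgCl.isNonarchimedean p _ _).trans (max_le h.le hy.le)
  · by_contra hlt
    push Not at hlt
    have h1 : y = x - (x - y) := by ring
    have h2 : ‖y‖ < 1 := by
      rw [h1]
      exact (norm_sub_le_max₃ _ _).trans_lt (max_lt hlt h)
    rw [hy] at h2
    exact lt_irrefl _ h2

/-- Algebraic integers of `ℚ̄_p` have norm at most one. [folklore] -/
private theorem norm_le_one_of_isIntegral₃ {x : PadicAlgCl p} (hx : IsIntegral ℤ x) :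
    ‖x‖ ≤ 1 := by
  have hv := Valuation.integer.integers (Valued.v (R := PadicAlgCl p))
  have hx' : IsIntegral (Valued.v (R := PadicAlgCl p)).integer x := hx.tower_top
  have h := (hv.isIntegral_iff_v_le_one).mp hx'
  rw [PadicAlgCl.valuation_def] at h
  exact_mod_cast h

/-- An integer divisible by `p` has norm `< 1` in `ℚ̄_p`. [folklore] -/
private theorem norm_intCast_lt_one_of_dvd₃ {z : ℤ} (hz : (p : ℤ) ∣ z) :
    ‖(z : PadicAlgCl p)‖ < 1 := by
  rw [← map_intCast (algebraMap ℚ_[p] (PadicAlgCl p)) z]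
  change ‖((z : ℚ_[p]) : PadicAlgCl p)‖ < 1
  rw [PadicAlgCl.norm_extends]
  exact Padic.norm_intCast_lt_one_iff.2 hz

/-- A finite sum of elements of norm `< 1` has norm `< 1` (ultrametric inequality). [folklore] -/
private theorem norm_sum_lt_one₃ {α : Type*} (s : Finset α) (u : α → PadicAlgCl p)
    (h : ∀ a ∈ s, ‖u a‖ < 1) : ‖∑ a ∈ s, u a‖ < 1 := by
  rcases s.eq_empty_or_nonempty with rfl | hs
  · simp
  · obtain ⟨a, ha, hle⟩ := IsUltrametricDist.exists_norm_finsetSum_le_of_nonempty hs u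
    exact hle.trans_lt (h a ha)

/-- A product of an element of norm `≤ 1` and one of norm `< 1` has norm `< 1`. [folklore] -/
private theorem norm_mul_lt_one_of_le_of_lt {x y : PadicAlgCl p} (hx : ‖x‖ ≤ 1) (hy : ‖y‖ < 1) :
    ‖x * y‖ < 1 := by
  rw [norm_mul]
  exact mul_lt_one_of_nonneg_of_lt_one_right hx (norm_nonneg _) hy

end Norm

/-! ### §1 The Deligne–Serre ∘ Atkin–Lehner–Li pipeline for an abstract mod-`𝔪` eigenform -/

section Pipeline

variable {p : ℕ} [Fact p.Prime]

set_option maxHeartbeats 1600000 in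
/-- **From a mod-`𝔪` eigenform to a newform, keeping the eigenform and ALL its eigenvalues.**  Let
`x ∈ S_k(Γ₁(N'))`, `k ≥ 1`, lie in the trivial-nebentypus subspace, have `p`-integral coefficients
through `ι⁻¹` with `a₁(x)` a unit, and be an eigenvector MODULO `𝔪` of every Hecke operator `T_q`
(`q` prime; `U_q` for `q ∣ N'`) with `p`-integral approximate eigenvalues `A_q`:
`‖ι⁻¹aₙ(T_q x) − A_q ι⁻¹aₙ(x)‖ < 1` for all `n`.  Then there are a divisor `M ∣ N'`, a newform
`g ∈ S_k(Γ₀(M))`, and a NON-ZERO `F ∈ S_k(Γ₀(N'))` with `T_q F = u_q F` for EVERY prime `q`,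
`‖ι⁻¹u_q − A_q‖ < 1`, `a_q(g) = u_q` for `q ∤ N'`, and `F` a combination of the old forms `[α_d]_k g`,
`M d ∣ N'`.  Proof: the Deligne–Serre lifting lemma for the commuting family of all `T_q` on the
integral lattice of `S_k(N', 𝟙)` (`DeligneSerreLift.exists_eigenform_of_congruence`), descent of the
lift to `Γ₀(N')` (`exists_liftToGamma1_eq_of_forall_diamondOp_eq`, `heckeT_liftToGamma1`), and the
Atkin–Lehner basis (`exists_isNewform0_mem_span_of_eigenpacket`).
[cite: DeligneSerreASENS1974, Lemme 6.11] [cite: DiamondShurman2005, Thm. 5.8.3] -/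
theorem exists_isNewform0_eigenform_of_modEigenform (ι : PadicAlgCl p ≃+* ℂ) {N' : ℕ} [NeZero N']
    {k : ℤ} (hk : 1 ≤ k) {x : CuspForm (Gamma1 N') k} (hxW : x ∈ nebentypusSubspace N' k 1)
    (hxint : ∀ n, ‖ι.symm (cuspCoeff x n)‖ ≤ 1) (hx1 : ‖ι.symm (cuspCoeff x 1)‖ = 1)
    (A : ℕ → PadicAlgCl p) (hAint : ∀ q, ‖A q‖ ≤ 1)
    (hcongT : ∀ (q : ℕ) (hq : q.Prime) (n : ℕ),
      ‖ι.symm (cuspCoeff ((haveI : NeZero q := ⟨hq.ne_zero⟩; heckeT (Gamma1 N') k q) x) n) -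
        A q * ι.symm (cuspCoeff x n)‖ < 1) :
    ∃ (M : ℕ) (_ : NeZero M) (_ : M ∣ N') (g : CuspForm (Gamma0 M) k) (F : CuspForm (Gamma0 N') k)
      (u : ℕ → ℂ), IsNewform0 g ∧ F ≠ 0 ∧
      (∀ (q : ℕ) (hq : q.Prime),
        (haveI : NeZero q := ⟨hq.ne_zero⟩; heckeT (Gamma0 N') k q F) = u q • F) ∧
      (∀ q : ℕ, q.Prime → ‖ι.symm (u q) - A q‖ < 1) ∧
      (∀ q : ℕ, q.Prime → ¬ q ∣ N' → (qExpansion 1 ⇑g).coeff q = u q) ∧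
      F ∈ Submodule.span ℂ
        {v | ∃ (d : ℕ) (_ : NeZero d), M * d ∣ N' ∧ v = degeneracyMap0 M N' d k g} := by
  classical
  have hp : p.Prime := Fact.out
  -- ### the commuting family of all `T_q`
  let TL : ℕ → Module.End ℂ (CuspForm (Gamma1 N') k) := fun q ↦
    if hq : q = 0 then 0 else (haveI : NeZero q := ⟨hq⟩; heckeT (Gamma1 N') k q)
  have hTL : ∀ (q : ℕ) (hq : q ≠ 0),
      TL q = (haveI : NeZero q := ⟨hq⟩; heckeT (Gamma1 N') k q) := fun q hq ↦ dif_neg hq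
  let 𝒯 : Set (Module.End ℂ (CuspForm (Gamma1 N') k)) := {T | ∃ q : ℕ, q.Prime ∧ T = TL q}
  have hcomm : ∀ S ∈ 𝒯, ∀ T ∈ 𝒯, Commute S T := by
    rintro S ⟨q, hq, rfl⟩ T ⟨q', hq', rfl⟩
    rw [hTL q hq.ne_zero, hTL q' hq'.ne_zero]
    haveI : NeZero q := ⟨hq.ne_zero⟩
    haveI : NeZero q' := ⟨hq'.ne_zero⟩
    exact heckeT_comm_holds N' k q q'
  have hdiam : ∀ T ∈ 𝒯, ∀ d : (ZMod N')ˣ, Commute T (diamondOp N' k (d : ZMod N')) := by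
    rintro T ⟨q, hq, rfl⟩ d
    rw [hTL q hq.ne_zero]
    haveI : NeZero q := ⟨hq.ne_zero⟩
    exact heckeT_diamondOp_comm_holds N' k q (d : ZMod N')
  have hΛ : ∀ T ∈ 𝒯, ∀ y ∈ integralLattice1 N' k, T y ∈ integralLattice1 N' k := by
    rintro T ⟨q, hq, rfl⟩ y hy
    rw [hTL q hq.ne_zero]
    haveI : NeZero q := ⟨hq.ne_zero⟩
    exact heckeT_mem_integralLattice1 hk hy q hq
  -- ### the targets (unique modulo `𝔪`)
  let P : Module.End ℂ (CuspForm (Gamma1 N') k) → PadicAlgCl p → Prop := fun T c ↦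
    ‖c‖ ≤ 1 ∧ ∀ n, ‖ι.symm (cuspCoeff (T x) n) - c * ι.symm (cuspCoeff x n)‖ < 1
  let a : Module.End ℂ (CuspForm (Gamma1 N') k) → PadicAlgCl p := fun T ↦
    if h : ∃ c, P T c then h.choose else 0
  have haP : ∀ T c, P T c → P T (a T) := by
    intro T c hc
    have h : ∃ c, P T c := ⟨c, hc⟩
    simp only [a, dif_pos h]
    exact h.choose_spec
  have hPuniq : ∀ T c₁ c₂, P T c₁ → P T c₂ → ‖c₁ - c₂‖ < 1 := by
    intro T c₁ c₂ h₁ h₂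
    have h := norm_sub_lt_one_trans₃ (by rw [← norm_neg, neg_sub]; exact h₁.2 1) (h₂.2 1)
    rw [← sub_mul, norm_mul, hx1, mul_one] at h
    exact h
  have hPT : ∀ (q : ℕ) (hq : q.Prime), P (TL q) (A q) := by
    intro q hq
    refine ⟨hAint q, fun n ↦ ?_⟩
    rw [hTL q hq.ne_zero]
    exact hcongT q hq n
  have ha : ∀ T ∈ 𝒯, ‖a T‖ ≤ 1 := by
    intro T hT
    by_cases h : ∃ c, P T c
    · exact (haP T _ h.choose_spec).1
    · simp only [a, dif_neg h, norm_zero]; exact zero_le_one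
  have hcongr : ∀ T ∈ 𝒯, ∀ n,
      ‖ι.symm (cuspCoeff (T x) n) - a T * ι.symm (cuspCoeff x n)‖ < 1 := by
    rintro T ⟨q, hq, rfl⟩ n
    exact (haP _ _ (hPT q hq)).2 n
  have hm : ¬ p ∣ 1 := hp.not_dvd_one
  have hχm : (1 : DirichletCharacter ℂ N') ^ 1 = 1 := pow_one 1
  -- ### the Deligne–Serre lift `g₁`
  obtain ⟨g₁, a', hg₁0, hg₁χ, hTg⟩ := DeligneSerreLift.exists_eigenform_of_congruence ι hk hm hχm
    𝒯 hcomm hdiam hΛ a ha hxW hxint hx1 hcongr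
  have hmemT : ∀ (q : ℕ), q.Prime → TL q ∈ 𝒯 := fun q hq ↦ ⟨q, hq, rfl⟩
  set u : ℕ → ℂ := fun q ↦ ι (a' (TL q)) with hu
  have hua : ∀ (q : ℕ), q.Prime → ‖ι.symm (u q) - A q‖ < 1 := by
    intro q hq
    rw [hu, RingEquiv.symm_apply_apply]
    have h1 := (hTg _ (hmemT q hq)).2.1
    have h2 := hPuniq _ _ _ (haP _ _ (hPT q hq)) (hPT q hq)
    exact norm_sub_lt_one_trans₃ h1 h2
  have hT₁ : ∀ (q : ℕ) (hq : q.Prime),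
      (haveI : NeZero q := ⟨hq.ne_zero⟩; heckeT (Gamma1 N') k q) g₁ = u q • g₁ := by
    intro q hq
    rw [← hTL q hq.ne_zero]
    exact (hTg _ (hmemT q hq)).2.2
  -- ### descent of `g₁` to `Γ₀(N')`
  have hg₁diam : ∀ d : ZMod N', IsUnit d → diamondOp N' k d g₁ = g₁ := by
    intro d hd
    obtain ⟨d', rfl⟩ := hd
    have h := (mem_nebentypusSubspace_iff_diamondOp.mp hg₁χ) d'
    rwa [MulChar.one_apply_coe, one_smul] at h
  obtain ⟨F, hF⟩ := exists_liftToGamma1_eq_of_forall_diamondOp_eq k g₁ hg₁diam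
  have hF0 : F ≠ 0 := by
    intro h0
    apply hg₁0
    rw [← hF, h0, map_zero]
  have hTF : ∀ (q : ℕ) (hq : q.Prime),
      (haveI : NeZero q := ⟨hq.ne_zero⟩; heckeT (Gamma0 N') k q F) = u q • F := by
    intro q hq
    haveI : NeZero q := ⟨hq.ne_zero⟩
    apply liftToGamma1_injective
    rw [← heckeT_liftToGamma1 N' k q F, map_smul, hF]
    exact hT₁ q hq
  -- ### the newform behind `F`
  obtain ⟨M, _, hMN, g, hgnew, hga, hspan⟩ :=
    exists_isNewform0_mem_span_of_eigenpacket hF0 (a := u) (fun q hq _ ↦ hTF q hq)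
  exact ⟨M, inferInstance, hMN, g, F, u, hgnew, hF0, hTF, hua, hga, hspan⟩

end Pipeline

/-! ### §2 The dichotomy at an auxiliary prime `ℓ ∥ N'` for an eigenform in the old span of a newform -/

section Dichotomy

/-- **`ℓ`-old or `ℓ`-new.**  Let `ℓ ∤ N` be a prime, `g ∈ S_k(Γ₀(M))` a newform with `M ∣ Nℓ`, and
`F ≠ 0` a combination of the old forms `[α_d]_k g` (`M d ∣ Nℓ`) at level `Nℓ` with `U_ℓ F = u F`.  Then
EITHER `ℓ ∤ M` — so `M ∣ N` — and `u² − a_ℓ(g) u + ℓ^{k-1} = 0` (the quadratic `U_ℓ`-relation on the old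
forms from a level prime to `ℓ`, `heckeT_heckeT_sub_add_eq_zero_of_mem_span_of_not_dvd`), OR `ℓ ∣ M`
(exactly, as `ℓ² ∤ Nℓ`) and `u = a_ℓ(g)` with `u² = ℓ^{k-2}` (`U_ℓ = a_ℓ(g)` on the old forms from an
`ℓ`-new level, `heckeT_eq_smul_of_mem_span_of_dvd`; `a_ℓ(g)² = ℓ^{k-2}`,
`IsNewform0.coeff_sq_eq_of_exactly_dvd`).  [cite: DiamondShurman2005, Prop. 5.6.2]
[cite: Miyake2006, Thm. 4.6.17] -/
theorem IsNewform0.dvd_or_dvd_of_mem_span_auxPrime {N ℓ M : ℕ} [NeZero N] [NeZero M]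
    (hℓ : ℓ.Prime) (hℓN : ¬ ℓ ∣ N) [NeZero (N * ℓ)] (hM : M ∣ N * ℓ) {k : ℤ}
    {g : CuspForm (Gamma0 M) k} (hg : IsNewform0 g) {F : CuspForm (Gamma0 (N * ℓ)) k} (hF0 : F ≠ 0)
    (hspan : F ∈ Submodule.span ℂ
      {v | ∃ (d : ℕ) (_ : NeZero d), M * d ∣ N * ℓ ∧ v = degeneracyMap0 M (N * ℓ) d k g})
    {u : ℂ} (hU : (haveI : NeZero ℓ := ⟨hℓ.ne_zero⟩; heckeT (Gamma0 (N * ℓ)) k ℓ F) = u • F) :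
    (M ∣ N ∧ u ^ 2 - (qExpansion 1 ⇑g).coeff ℓ * u + (ℓ : ℂ) ^ (k - 1) = 0) ∨
    (ℓ ∣ M ∧ u = (qExpansion 1 ⇑g).coeff ℓ ∧ u ^ 2 = (ℓ : ℂ) ^ (k - 2)) := by
  haveI : Fact ℓ.Prime := ⟨hℓ⟩
  haveI : NeZero ℓ := ⟨hℓ.ne_zero⟩
  have hp2 : ¬ ℓ ^ 2 ∣ N * ℓ := by
    rw [pow_two]
    intro h
    exact hℓN ((Nat.mul_dvd_mul_iff_right hℓ.pos).mp h)
  have hℓL : ℓ ∣ N * ℓ := dvd_mul_left ℓ N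
  by_cases hℓM : ℓ ∣ M
  · right
    -- `U_ℓ = a_ℓ(g)` on the old span, so `u = a_ℓ(g)`
    have h1 := heckeT_eq_smul_of_mem_span_of_dvd hℓM hp2 hg hspan
    rw [hU] at h1
    have hu : u = (qExpansion 1 ⇑g).coeff ℓ := by
      have h2 : (u - (qExpansion 1 ⇑g).coeff ℓ) • F = 0 := by rw [sub_smul, h1, sub_self]
      exact sub_eq_zero.mp ((smul_eq_zero.mp h2).resolve_right hF0)
    -- `ℓ ∥ M`
    obtain ⟨M', hM'⟩ := hℓM
    have hℓM' : ¬ ℓ ∣ M' := by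
      rintro ⟨M'', rfl⟩
      apply hp2
      exact (show ℓ ^ 2 ∣ M from ⟨M'', by rw [hM']; ring⟩).trans hM
    haveI : NeZero M' := ⟨fun h ↦ NeZero.ne M (by rw [hM', h, mul_zero])⟩
    refine ⟨⟨M', hM'⟩, hu, ?_⟩
    rw [hu]
    exact hg.coeff_sq_eq_of_exactly_dvd hM' hℓM'
  · left
    refine ⟨(Nat.Coprime.dvd_of_dvd_mul_right
      (Nat.coprime_comm.mp ((Nat.Prime.coprime_iff_not_dvd hℓ).mpr hℓM)) hM), ?_⟩
    have h := heckeT_heckeT_sub_add_eq_zero_of_mem_span_of_not_dvd hℓM hℓL hp2 hg hspan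
    rw [hU, map_smul, hU, smul_smul, smul_smul, ← sub_smul, ← add_smul] at h
    have h' : u * u - (qExpansion 1 ⇑g).coeff ℓ * u + (ℓ : ℂ) ^ (k - 1) = 0 :=
      (smul_eq_zero.mp h).resolve_right hF0
    rw [← pow_two] at h'
    exact h'

end Dichotomy

/-! ### §3 Congruence algebra in `ℚ̄_p`: roots of the `ℓ`-th Hecke polynomial, Ribet's congruence -/

section Congruence

variable {p : ℕ} [Fact p.Prime]

/-- A root of a monic quadratic with `p`-integral coefficients is `p`-integral (in `ℚ̄_p`):
`α² = A α − B`, `‖A‖, ‖B‖ ≤ 1 ⟹ ‖α‖ ≤ 1` (isosceles triangle principle). [folklore] -/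
private theorem norm_le_one_of_sq_sub_mul_add_eq_zero {α A B : PadicAlgCl p} (hA : ‖A‖ ≤ 1) (hB : ‖B‖ ≤ 1)
    (h : α ^ 2 - A * α + B = 0) : ‖α‖ ≤ 1 := by
  by_contra hα
  push Not at hα
  have hα0 : 0 < ‖α‖ := zero_lt_one.trans hα
  have heq : α ^ 2 = A * α - B := by linear_combination h
  have h1 : ‖A * α‖ < ‖α‖ ^ 2 := by
    rw [norm_mul, pow_two]
    calc ‖A‖ * ‖α‖ ≤ 1 * ‖α‖ := by gcongr
      _ < ‖α‖ * ‖α‖ := by rw [one_mul]; exact lt_mul_of_one_lt_left hα0 hα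
  have h2 : ‖B‖ < ‖α‖ ^ 2 := hB.trans_lt (by nlinarith)
  have h3 : ‖A * α - B‖ < ‖α‖ ^ 2 := (norm_sub_le_max₃ _ _).trans_lt (max_lt h1 h2)
  rw [← heq, norm_pow] at h3
  exact lt_irrefl _ h3

/-- **Existence of the two roots of the `ℓ`-th Hecke polynomial in `ℚ̄_p`**: for `p`-integral `A, B`
there are `p`-integral `α, β ∈ ℚ̄_p` with `α + β = A`, `α β = B` (`ℚ̄_p` is algebraically closed;
integrality by `norm_le_one_of_sq_sub_mul_add_eq_zero`). [folklore] -/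
private theorem exists_roots_of_norm_le_one {A B : PadicAlgCl p} (hA : ‖A‖ ≤ 1) (hB : ‖B‖ ≤ 1) :
    ∃ α β : PadicAlgCl p, α + β = A ∧ α * β = B ∧ ‖α‖ ≤ 1 ∧ ‖β‖ ≤ 1 := by
  -- a root of `X² − A X + B`
  obtain ⟨α, hα⟩ : ∃ α : PadicAlgCl p, α ^ 2 - A * α + B = 0 := by
    let P : Polynomial (PadicAlgCl p) :=
      Polynomial.C 1 * Polynomial.X ^ 2 + Polynomial.C (-A) * Polynomial.X + Polynomial.C B
    have hdeg : P.degree = 2 := Polynomial.degree_quadratic one_ne_zero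
    obtain ⟨α, hα⟩ := IsAlgClosed.exists_root P (by rw [hdeg]; decide)
    refine ⟨α, ?_⟩
    have : Polynomial.eval α P = 0 := hα
    simp only [P, Polynomial.eval_add, Polynomial.eval_mul, Polynomial.eval_C, Polynomial.eval_pow,
      Polynomial.eval_X, one_mul, neg_mul] at this
    linear_combination this
  refine ⟨α, A - α, by ring, by linear_combination (-1 : PadicAlgCl p) * hα,
    norm_le_one_of_sq_sub_mul_add_eq_zero hA hB hα, ?_⟩
  refine norm_le_one_of_sq_sub_mul_add_eq_zero hA hB (α := A - α) ?_
  linear_combination hα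

/-- **Ribet's level-raising congruence from an `ℓ`-new companion (norm form).**  In `ℚ̄_p` let
`α² − A α + ℓ^{e₀} = 0` with `‖A‖ ≤ 1`, `e₀ ≥ 1`, let `p ∤ ℓ` and `(p − 1) ∣ w`, and let `u ≡ α (mod 𝔪)`
satisfy `u² = ℓ^{e₀ + w − 1}` (the `U_ℓ`-eigenvalue of an `ℓ`-new eigenform of weight
`k = e₀ + w + 1`: `a_ℓ² = ℓ^{k-2}`).  Then `A² ≡ ℓ^{e₀-1}(ℓ+1)² (mod 𝔪)`:
`α² ≡ u² = ℓ^{e₀+w-1} ≡ ℓ^{e₀-1}` (Fermat), `A α = α² + ℓ^{e₀} ≡ ℓ^{e₀-1}(1 + ℓ)`, square and cancel the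
unit `ℓ^{e₀-1}`.  [cite: Ribet1984ICM, Thm. 1 (necessity of the congruence)] -/
theorem norm_sq_sub_levelRaising_lt_one {α u A : PadicAlgCl p} {ℓ e₀ w : ℕ} (hpℓ : ¬ p ∣ ℓ)
    (hpw : (p - 1) ∣ w) (he₀ : 1 ≤ e₀) (hA : ‖A‖ ≤ 1)
    (hα : α ^ 2 - A * α + (ℓ : PadicAlgCl p) ^ e₀ = 0) (huα : ‖u - α‖ < 1)
    (hu : u ^ 2 = (ℓ : PadicAlgCl p) ^ (e₀ + w - 1)) :
    ‖A ^ 2 - (ℓ : PadicAlgCl p) ^ (e₀ - 1) * ((ℓ : PadicAlgCl p) + 1) ^ 2‖ < 1 := by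
  have hp : p.Prime := Fact.out
  -- integrality
  have hℓ1 : ‖(ℓ : PadicAlgCl p)‖ = 1 := by
    have h := DeligneSerreLift.norm_intCast_eq_one_of_not_dvd (p := p) (z := (ℓ : ℤ))
      (by exact_mod_cast hpℓ)
    simpa using h
  have hℓle : ‖(ℓ : PadicAlgCl p)‖ ≤ 1 := hℓ1.le
  have hℓpow : ∀ m : ℕ, ‖(ℓ : PadicAlgCl p) ^ m‖ = 1 := fun m ↦ by rw [norm_pow, hℓ1, one_pow]
  have hαle : ‖α‖ ≤ 1 := norm_le_one_of_sq_sub_mul_add_eq_zero hA (hℓpow e₀).le hα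
  have hule : ‖u‖ ≤ 1 := by
    have : u = (u - α) + α := by ring
    rw [this]
    exact (PadicAlgCl.isNonarchimedean p _ _).trans (max_le huα.le hαle)
  -- `ℓ^{e₀+w-1} ≡ ℓ^{e₀-1}` (Fermat)
  have hFermat : ‖(ℓ : PadicAlgCl p) ^ (e₀ + w - 1) - (ℓ : PadicAlgCl p) ^ (e₀ - 1)‖ < 1 := by
    have hdvd : (p : ℤ) ∣ (ℓ : ℤ) ^ (e₀ + w - 1) - (ℓ : ℤ) ^ (e₀ - 1) := by
      have hfac : (ℓ : ℤ) ^ (e₀ + w - 1) - (ℓ : ℤ) ^ (e₀ - 1) =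
          (ℓ : ℤ) ^ (e₀ - 1) * ((ℓ : ℤ) ^ w - 1) := by
        rw [show e₀ + w - 1 = (e₀ - 1) + w by omega, pow_add]; ring
      rw [hfac]
      apply Dvd.dvd.mul_left
      have hcop : IsCoprime (ℓ : ℤ) p := by
        rw [Nat.isCoprime_iff_coprime]
        exact (Nat.coprime_comm.mp ((Nat.Prime.coprime_iff_not_dvd hp).mpr hpℓ))
      obtain ⟨c, hc⟩ := hpw
      have h1 : (ℓ : ℤ) ^ (p - 1) ≡ 1 [ZMOD p] := Int.ModEq.pow_card_sub_one_eq_one hp hcop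
      have h2 : (ℓ : ℤ) ^ w ≡ 1 [ZMOD p] := by
        rw [hc, pow_mul]
        simpa using h1.pow c
      exact Int.ModEq.dvd h2.symm
    have h := norm_intCast_lt_one_of_dvd₃ (p := p) hdvd
    push_cast at h
    exact h
  -- `α² ≡ u²`
  have h1 : ‖α ^ 2 - u ^ 2‖ < 1 := by
    have : α ^ 2 - u ^ 2 = (α + u) * (α - u) := by ring
    rw [this]
    refine norm_mul_lt_one_of_le_of_lt ((PadicAlgCl.isNonarchimedean p _ _).trans
      (max_le hαle hule)) ?_
    rwa [← norm_neg, neg_sub]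
  -- `α² ≡ ℓ^{e₀-1}`
  have h2 : ‖α ^ 2 - (ℓ : PadicAlgCl p) ^ (e₀ - 1)‖ < 1 :=
    norm_sub_lt_one_trans₃ (norm_sub_lt_one_trans₃ h1 (by rw [hu]; exact hFermat)) (by simp)
  -- `A α = α² + ℓ^{e₀} ≡ ℓ^{e₀-1}(1 + ℓ) =: c`
  set c : PadicAlgCl p := (ℓ : PadicAlgCl p) ^ (e₀ - 1) * ((ℓ : PadicAlgCl p) + 1) with hc
  have hcle : ‖c‖ ≤ 1 := by
    rw [hc, norm_mul, hℓpow, one_mul]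
    exact (PadicAlgCl.isNonarchimedean p _ _).trans (max_le hℓle (by rw [norm_one]))
  have hAα : A * α = α ^ 2 + (ℓ : PadicAlgCl p) ^ e₀ := by linear_combination -hα
  have h3 : ‖A * α - c‖ < 1 := by
    have : A * α - c = α ^ 2 - (ℓ : PadicAlgCl p) ^ (e₀ - 1) := by
      rw [hAα, hc, show e₀ = (e₀ - 1) + 1 from by omega, pow_succ]
      simp only [Nat.add_sub_cancel]
      ring
    rw [this]
    exact h2
  -- square: `A² α² ≡ c²`, and `A² α² ≡ A² ℓ^{e₀-1}`
  have h4 : ‖A ^ 2 * α ^ 2 - c ^ 2‖ < 1 := by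
    have : A ^ 2 * α ^ 2 - c ^ 2 = (A * α + c) * (A * α - c) := by ring
    rw [this]
    refine norm_mul_lt_one_of_le_of_lt ((PadicAlgCl.isNonarchimedean p _ _).trans (max_le ?_ hcle)) h3
    rw [norm_mul]
    exact mul_le_one₀ hA (norm_nonneg _) hαle
  have h5 : ‖A ^ 2 * α ^ 2 - A ^ 2 * (ℓ : PadicAlgCl p) ^ (e₀ - 1)‖ < 1 := by
    rw [← mul_sub]
    refine norm_mul_lt_one_of_le_of_lt ?_ h2
    rw [norm_pow]
    exact pow_le_one₀ (norm_nonneg _) hA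
  have h6 : ‖A ^ 2 * (ℓ : PadicAlgCl p) ^ (e₀ - 1) - c ^ 2‖ < 1 :=
    norm_sub_lt_one_trans₃ (by rw [← norm_neg, neg_sub]; exact h5) h4
  -- cancel the unit `ℓ^{e₀-1}`
  have hfac : A ^ 2 * (ℓ : PadicAlgCl p) ^ (e₀ - 1) - c ^ 2 =
      (ℓ : PadicAlgCl p) ^ (e₀ - 1) *
        (A ^ 2 - (ℓ : PadicAlgCl p) ^ (e₀ - 1) * ((ℓ : PadicAlgCl p) + 1) ^ 2) := by
    rw [hc]; ring
  rw [hfac, norm_mul, hℓpow, one_mul] at h6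
  exact h6

/-- **The congruence at the auxiliary prime in the `ℓ`-old case.**  In `ℚ̄_p` let
`α² − A α + ℓ^{e₀} = 0`, `α β = ℓ^{e₀}` with `‖α‖, ‖β‖ ≤ 1` and `p ∤ ℓ` (so `α` is a unit), `(p − 1) ∣ w`,
and let `u ≡ α (mod 𝔪)` satisfy the `T_ℓ`-relation of an `ℓ`-OLD eigenform of weight `k = e₀ + w + 1`
coming from a newform with `ℓ`-th coefficient `a`: `u² − a u + ℓ^{e₀+w} = 0`, `‖a‖ ≤ 1`.  Then
`a ≡ A (mod 𝔪)`: `a u = u² + ℓ^{e₀+w} ≡ α² + ℓ^{e₀} = A α` and `a u ≡ a α`, cancel the unit `α`.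
[cite: DiamondShurman2005, Prop. 5.6.2] -/
theorem norm_sub_lt_one_of_oldRelation {α β u A a : PadicAlgCl p} {ℓ e₀ w : ℕ} (hpℓ : ¬ p ∣ ℓ)
    (hpw : (p - 1) ∣ w) (ha : ‖a‖ ≤ 1) (hαle : ‖α‖ ≤ 1) (hβle : ‖β‖ ≤ 1)
    (hα : α ^ 2 - A * α + (ℓ : PadicAlgCl p) ^ e₀ = 0) (hαβ : α * β = (ℓ : PadicAlgCl p) ^ e₀)
    (huα : ‖u - α‖ < 1) (hu : u ^ 2 - a * u + (ℓ : PadicAlgCl p) ^ (e₀ + w) = 0) :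
    ‖a - A‖ < 1 := by
  have hp : p.Prime := Fact.out
  have hℓ1 : ‖(ℓ : PadicAlgCl p)‖ = 1 := by
    have h := DeligneSerreLift.norm_intCast_eq_one_of_not_dvd (p := p) (z := (ℓ : ℤ))
      (by exact_mod_cast hpℓ)
    simpa using h
  have hℓpow : ∀ m : ℕ, ‖(ℓ : PadicAlgCl p) ^ m‖ = 1 := fun m ↦ by rw [norm_pow, hℓ1, one_pow]
  -- `α` is a unit
  have hα1 : ‖α‖ = 1 := by
    apply le_antisymm hαle
    by_contra hlt
    push Not at hlt
    have h1 : ‖α * β‖ < 1 := by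
      rw [norm_mul]
      exact mul_lt_one_of_nonneg_of_lt_one_left (norm_nonneg _) hlt hβle
    rw [hαβ, hℓpow] at h1
    exact lt_irrefl _ h1
  have hule : ‖u‖ ≤ 1 := by
    have : u = (u - α) + α := by ring
    rw [this]
    exact (PadicAlgCl.isNonarchimedean p _ _).trans (max_le huα.le hαle)
  -- Fermat: `ℓ^{e₀+w} ≡ ℓ^{e₀}`
  have hFermat : ‖(ℓ : PadicAlgCl p) ^ (e₀ + w) - (ℓ : PadicAlgCl p) ^ e₀‖ < 1 := by
    have hdvd : (p : ℤ) ∣ (ℓ : ℤ) ^ (e₀ + w) - (ℓ : ℤ) ^ e₀ := by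
      have hfac : (ℓ : ℤ) ^ (e₀ + w) - (ℓ : ℤ) ^ e₀ = (ℓ : ℤ) ^ e₀ * ((ℓ : ℤ) ^ w - 1) := by
        rw [pow_add]; ring
      rw [hfac]
      apply Dvd.dvd.mul_left
      have hcop : IsCoprime (ℓ : ℤ) p := by
        rw [Nat.isCoprime_iff_coprime]
        exact (Nat.coprime_comm.mp ((Nat.Prime.coprime_iff_not_dvd hp).mpr hpℓ))
      obtain ⟨c, hc⟩ := hpw
      have h1 : (ℓ : ℤ) ^ (p - 1) ≡ 1 [ZMOD p] := Int.ModEq.pow_card_sub_one_eq_one hp hcop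
      have h2 : (ℓ : ℤ) ^ w ≡ 1 [ZMOD p] := by
        rw [hc, pow_mul]
        simpa using h1.pow c
      exact Int.ModEq.dvd h2.symm
    have h := norm_intCast_lt_one_of_dvd₃ (p := p) hdvd
    push_cast at h
    exact h
  -- `a u = u² + ℓ^{e₀+w}`, `A α = α² + ℓ^{e₀}`
  have hau : a * u = u ^ 2 + (ℓ : PadicAlgCl p) ^ (e₀ + w) := by linear_combination -hu
  have hAα : A * α = α ^ 2 + (ℓ : PadicAlgCl p) ^ e₀ := by linear_combination -hα
  -- `u² ≡ α²`
  have h1 : ‖u ^ 2 - α ^ 2‖ < 1 := by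
    have : u ^ 2 - α ^ 2 = (u + α) * (u - α) := by ring
    rw [this]
    exact norm_mul_lt_one_of_le_of_lt ((PadicAlgCl.isNonarchimedean p _ _).trans
      (max_le hule hαle)) huα
  -- `a u ≡ A α`
  have h2 : ‖a * u - A * α‖ < 1 := by
    rw [hau, hAα, show u ^ 2 + (ℓ : PadicAlgCl p) ^ (e₀ + w) - (α ^ 2 + (ℓ : PadicAlgCl p) ^ e₀) =
      (u ^ 2 - α ^ 2) + ((ℓ : PadicAlgCl p) ^ (e₀ + w) - (ℓ : PadicAlgCl p) ^ e₀) by ring]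
    exact (PadicAlgCl.isNonarchimedean p _ _).trans_lt (max_lt h1 hFermat)
  -- `a u ≡ a α`
  have h3 : ‖a * u - a * α‖ < 1 := by
    rw [← mul_sub]
    exact norm_mul_lt_one_of_le_of_lt ha huα
  -- hence `(a − A) α ≡ 0`, and `α` is a unit
  have h4 : ‖(a - A) * α‖ < 1 := by
    rw [show (a - A) * α = (a * u - A * α) - (a * u - a * α) by ring]
    exact (norm_sub_le_max₃ _ _).trans_lt (max_lt h2 h3)
  rw [norm_mul, hα1, mul_one] at h4
  exact h4

end Congruence

/-! ### §4 The `ℓ`-stabilised coefficient sequence satisfies the level-`Nℓ` Hecke recursions -/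

section Stabilised

/-- **Hecke recursions of the `ℓ`-stabilisation.**  Let `a : ℕ → R` satisfy the level-`N` recursions
`a(qm) = a(q)a(m) − 𝟙_{q∤N} q^e 𝟙_{q∣m} a(m/q)` for every prime `q` (the coefficients of a normalised
eigenform of weight `e + 1`, Diamond–Shurman Prop. 5.8.5), let `ℓ ∤ N` be a prime and
`α + β = a(ℓ)`, `αβ = ℓ^e`.  Then `c(n) = a(n) − β 𝟙_{ℓ∣n} a(n/ℓ)` — the coefficients of
`f − β f(ℓτ)` — satisfy the level-`Nℓ` recursions with the SAME eigenvalues at `q ≠ ℓ`, and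
`c(ℓn) = α c(n)` (so `U_ℓ` acts by `α`).  [cite: DiamondShurman2005, Prop. 5.8.5 and §5.7] -/
theorem stabilised_heckeRecursion {R : Type*} [CommRing R] (a : ℕ → R) (N e ℓ : ℕ) (hℓ : ℓ.Prime)
    (hℓN : ¬ ℓ ∣ N) (α β : R) (hsum : α + β = a ℓ) (hprod : α * β = (ℓ : R) ^ e)
    (hrec : ∀ q : ℕ, q.Prime → ∀ m : ℕ,
      a (q * m) = a q * a m - (if q ∣ N then 0 else (q : R) ^ e * (if q ∣ m then a (m / q) else 0)))
    (c : ℕ → R) (hc : ∀ n, c n = a n - β * (if ℓ ∣ n then a (n / ℓ) else 0)) :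
    (∀ q : ℕ, q.Prime → q ≠ ℓ → ∀ n : ℕ,
      c (q * n) = a q * c n -
        (if q ∣ N * ℓ then 0 else (q : R) ^ e * (if q ∣ n then c (n / q) else 0))) ∧
    (∀ n : ℕ, c (ℓ * n) = α * c n) := by
  constructor
  · intro q hq hqℓ n
    have hqℓ' : ¬ q ∣ ℓ := fun h ↦ hqℓ ((Nat.prime_dvd_prime_iff_eq hq hℓ).mp h)
    have hcop : Nat.Coprime q ℓ := (Nat.Prime.coprime_iff_not_dvd hq).mpr hqℓ'
    have hqNℓ : q ∣ N * ℓ ↔ q ∣ N :=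
      ⟨fun h ↦ Nat.Coprime.dvd_of_dvd_mul_right hcop h, fun h ↦ h.mul_right ℓ⟩
    by_cases hℓn : ℓ ∣ n
    · -- `n = ℓ m`
      obtain ⟨m, hnm⟩ := hℓn
      have hℓqn : ℓ ∣ q * n := ⟨q * m, by rw [hnm]; ring⟩
      have hd1 : q * n / ℓ = q * m := by
        rw [hnm, show q * (ℓ * m) = ℓ * (q * m) by ring, Nat.mul_div_cancel_left _ hℓ.pos]
      have hd2 : n / ℓ = m := by rw [hnm, Nat.mul_div_cancel_left _ hℓ.pos]
      have e1 : c (q * n) = a q * a n - (if q ∣ N then 0 else (q : R) ^ e *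
          (if q ∣ n then a (n / q) else 0)) - β * (a q * a m -
          (if q ∣ N then 0 else (q : R) ^ e * (if q ∣ m then a (m / q) else 0))) := by
        rw [hc, if_pos hℓqn, hd1, hrec q hq n, hrec q hq m]
      have e2 : c n = a n - β * a m := by rw [hc, if_pos ⟨m, hnm⟩, hd2]
      by_cases hqN : q ∣ N
      · rw [e1, e2, if_pos hqN, if_pos hqN, if_pos (hqNℓ.mpr hqN)]
        ring
      · rw [e1, e2, if_neg hqN, if_neg hqN, if_neg (mt hqNℓ.mp hqN)]
        by_cases hqn : q ∣ n
        · -- `q ∣ m`, `m = q r`, `n / q = ℓ r`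
          have hqm : q ∣ m := Nat.Coprime.dvd_of_dvd_mul_left hcop (by rw [← hnm]; exact hqn)
          obtain ⟨r, hmr⟩ := hqm
          have hd3 : n / q = ℓ * r := by
            rw [hnm, hmr, show ℓ * (q * r) = q * (ℓ * r) by ring, Nat.mul_div_cancel_left _ hq.pos]
          have hd4 : m / q = r := by rw [hmr, Nat.mul_div_cancel_left _ hq.pos]
          have e3 : c (n / q) = a (ℓ * r) - β * a r := by
            rw [hd3, hc, if_pos (dvd_mul_right ℓ r), Nat.mul_div_cancel_left _ hℓ.pos]
          rw [if_pos hqn, if_pos hqn, if_pos ⟨r, hmr⟩, e3, hd3, hd4]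
          ring
        · have hqm : ¬ q ∣ m := fun h ↦ hqn (by rw [hnm]; exact h.mul_left ℓ)
          rw [if_neg hqn, if_neg hqn, if_neg hqm]
          ring
    · -- `ℓ ∤ n`
      have hℓqn : ¬ ℓ ∣ q * n := fun h ↦ hℓn (Nat.Coprime.dvd_of_dvd_mul_left hcop.symm h)
      have e1 : c (q * n) = a (q * n) := by rw [hc, if_neg hℓqn, mul_zero, sub_zero]
      have e2 : c n = a n := by rw [hc, if_neg hℓn, mul_zero, sub_zero]
      rw [e1, e2, hrec q hq n]
      by_cases hqN : q ∣ N
      · rw [if_pos hqN, if_pos (hqNℓ.mpr hqN)]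
      · rw [if_neg hqN, if_neg (mt hqNℓ.mp hqN)]
        by_cases hqn : q ∣ n
        · have hℓnq : ¬ ℓ ∣ n / q := fun h ↦ hℓn (h.trans (Nat.div_dvd_of_dvd hqn))
          have e3 : c (n / q) = a (n / q) := by rw [hc, if_neg hℓnq, mul_zero, sub_zero]
          rw [if_pos hqn, if_pos hqn, e3]
        · rw [if_neg hqn, if_neg hqn]
  · intro n
    have e1 : c (ℓ * n) = a (ℓ * n) - β * a n := by
      rw [hc, if_pos (dvd_mul_right ℓ n), Nat.mul_div_cancel_left _ hℓ.pos]
    rw [e1, hrec ℓ hℓ n, if_neg hℓN, hc n]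
    by_cases hℓn : ℓ ∣ n
    · simp only [if_pos hℓn]
      rw [← hsum, ← hprod]
      ring
    · simp only [if_neg hℓn, mul_zero, sub_zero]
      rw [← hsum]
      ring

end Stabilised

/-! ### §5 The main theorem: Deligne–Serre on the `ℓ`-stabilised form, and the descent -/

section Main

variable {p : ℕ} [Fact p.Prime]

set_option maxHeartbeats 1600000 in
/-- **Congruent newforms through an auxiliary prime `ℓ`, with Ribet's obstruction to being `ℓ`-new.**
Let `p` be a prime, `ι : ℚ̄_p ≃ ℂ`, `f ∈ S_{k₀}(Γ₀(N))` a newform of weight `k₀ ≥ 2`, `ℓ` a prime with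
`ℓ ∤ N` and `p ∤ ℓ`, and `G ∈ M_w(Γ₁(Nℓ))` (`(p − 1) ∣ w`, weight written `k₁ = w`) a `Γ₀(Nℓ)`-invariant
form with `q`-expansion `≡ 1 (mod 𝔪)` through `ι⁻¹`.  Then there are `M ∣ Nℓ` and a newform
`g ∈ S_{k₀+w}(Γ₀(M))` with `‖ι⁻¹a_q(g) − ι⁻¹a_q(f)‖ < 1` for every prime `q ∤ Nℓ`, AND: if `ℓ ∣ M` then
`‖ι⁻¹a_ℓ(f)² − ℓ^{k₀−2}(ℓ+1)²‖ < 1` (Ribet's level-raising congruence); and if `ℓ ∤ M` (so `M ∣ N`) then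
ALSO `a_ℓ(g) ≡ a_ℓ(f) (mod 𝔪)` (the `T_ℓ`-relation `u² − a_ℓ(g)u + ℓ^{k−1} = 0` of the `ℓ`-old lift,
`u ≡ α` a unit).  Proof: §4 (the
`ℓ`-stabilised old form `(f − β ι_ℓ f)·G` is a mod-`𝔪` eigenform of ALL `T_q` at level `Nℓ`, `U_ℓ`
with eigenvalue `α`), §1 (Deligne–Serre lift + the newform behind it, keeping `U_ℓ F = u F`, `u ≡ α`),
§2 (the dichotomy) and §3 (the congruence in the `ℓ`-new case).
[cite: DeligneSerreASENS1974, Lemme 6.11] [cite: DiamondShurman2005, Prop. 5.6.2 and Thm. 5.8.3]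
[cite: Ribet1984ICM, Thm. 1 (necessity of the congruence)] -/
theorem exists_isNewform0_dvd_level_congr_of_multiplier_auxPrime (ι : PadicAlgCl p ≃+* ℂ)
    {N ℓ : ℕ} [NeZero N] [NeZero (N * ℓ)] (hℓ : ℓ.Prime) (hℓN : ¬ ℓ ∣ N) (hpℓ : ¬ p ∣ ℓ)
    {k₀ : ℤ} (hk₀ : 2 ≤ k₀) {f : CuspForm (Gamma0 N) k₀} (hf : IsNewform0 f)
    {w : ℕ} (hpw : (p - 1) ∣ w) {k₁ : ℤ} (hk₁ : k₁ = w) (G : ModularForm (Gamma1 (N * ℓ)) k₁)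
    (hGΓ : ∀ γ : SL(2, ℤ), γ ∈ Gamma0 (N * ℓ) → (⇑G : ℍ → ℂ) ∣[k₁] γ = ⇑G)
    (hG0 : (qExpansion 1 ⇑G).coeff 0 = 1)
    (hGm : ∀ j : ℕ, j ≠ 0 → ‖ι.symm ((qExpansion 1 ⇑G).coeff j)‖ < 1) :
    ∃ (M : ℕ) (_ : NeZero M) (_ : M ∣ N * ℓ) (g : CuspForm (Gamma0 M) (k₀ + k₁)),
      IsNewform0 g ∧
      (∀ q : ℕ, q.Prime → ¬ q ∣ N * ℓ →
        ‖ι.symm ((qExpansion 1 ⇑g).coeff q) - ι.symm ((qExpansion 1 ⇑f).coeff q)‖ < 1) ∧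
      (ℓ ∣ M → ‖ι.symm ((qExpansion 1 ⇑f).coeff ℓ) ^ 2 -
        (ℓ : PadicAlgCl p) ^ (k₀ - 2).toNat * ((ℓ : PadicAlgCl p) + 1) ^ 2‖ < 1) ∧
      (¬ ℓ ∣ M →
        ‖ι.symm ((qExpansion 1 ⇑g).coeff ℓ) - ι.symm ((qExpansion 1 ⇑f).coeff ℓ)‖ < 1) := by
  classical
  subst hk₁
  have hp : p.Prime := Fact.out
  haveI : NeZero ℓ := ⟨hℓ.ne_zero⟩
  have hK1 : (1 : ℤ) ≤ k₀ + w := by omega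
  have h1L := HeckeTGamma1.one_mem_strictPeriods_Gamma1 (N * ℓ)
  -- ### exponents: `k₀ - 1 = e₀`, `k₀ + w - 1 = e₀ + w`
  obtain ⟨e₀, he₀⟩ : ∃ e₀ : ℕ, k₀ - 1 = (e₀ : ℤ) := ⟨(k₀ - 1).toNat, by omega⟩
  have he₀1 : 1 ≤ e₀ := by omega
  have hzpow₀ : ∀ q : ℕ, (q : ℂ) ^ (k₀ - 1) = ((q ^ e₀ : ℕ) : ℂ) := fun q ↦ by
    rw [he₀, zpow_natCast, Nat.cast_pow]
  have hzpow : ∀ q : ℕ, (q : ℂ) ^ (k₀ + (w : ℤ) - 1) = ((q ^ (e₀ + w) : ℕ) : ℂ) := fun q ↦ by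
    rw [show k₀ + (w : ℤ) - 1 = ((e₀ + w : ℕ) : ℤ) by push_cast; omega, zpow_natCast,
      Nat.cast_pow]
  -- ### the coefficients of `f` in `ℚ̄_p` and their recursions
  set Af : ℕ → PadicAlgCl p := fun n ↦ ι.symm ((qExpansion 1 ⇑f).coeff n) with hAf
  have hAint : ∀ n, ‖Af n‖ ≤ 1 := fun n ↦
    norm_le_one_of_isIntegral₃ ((IsNewform0.isIntegral_coeff_holds hf n).map
      (ι.symm : ℂ →+* PadicAlgCl p).toIntAlgHom)
  have hA1 : Af 1 = 1 := by
    simp only [hAf]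
    rw [show (qExpansion 1 ⇑f).coeff 1 = 1 from hf.2.2, map_one]
  have hrecA : ∀ q : ℕ, q.Prime → ∀ m : ℕ, Af (q * m) = Af q * Af m -
      (if q ∣ N then 0 else (q : PadicAlgCl p) ^ e₀ * (if q ∣ m then Af (m / q) else 0)) := by
    intro q hq m
    by_cases hqN : q ∣ N <;> by_cases hqm : q ∣ m <;>
      simp only [hAf, hf.coeff_prime_mul hq m, hqN, hqm, if_true, if_false, map_sub, map_mul,
        mul_zero, sub_zero, hzpow₀, map_natCast, map_pow, Nat.cast_pow]
  -- ### the roots `α, β` of `X² − a_ℓ X + ℓ^{e₀}` in `ℚ̄_p`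
  have hℓle : ‖(ℓ : PadicAlgCl p)‖ ≤ 1 := by
    have h := DeligneSerreLift.norm_intCast_le_one (p := p) (ℓ : ℤ)
    simpa using h
  have hℓpow : ‖(ℓ : PadicAlgCl p) ^ e₀‖ ≤ 1 := by
    rw [norm_pow]; exact pow_le_one₀ (norm_nonneg _) hℓle
  obtain ⟨α, β, hαβ, hαβ', hαle, hβle⟩ := exists_roots_of_norm_le_one (hAint ℓ) hℓpow
  -- ### the stabilised sequence `c`
  set c : ℕ → PadicAlgCl p := fun n ↦ Af n - β * (if ℓ ∣ n then Af (n / ℓ) else 0) with hcdef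
  obtain ⟨hrec_c, hrec_ℓ⟩ :=
    stabilised_heckeRecursion Af N e₀ ℓ hℓ hℓN α β hαβ hαβ' hrecA c (fun n ↦ rfl)
  have hcint : ∀ n, ‖c n‖ ≤ 1 := fun n ↦ by
    simp only [hcdef]
    refine (norm_sub_le_max₃ _ _).trans (max_le (hAint n) ?_)
    rw [norm_mul]
    refine mul_le_one₀ hβle (norm_nonneg _) ?_
    split_ifs
    · exact hAint _
    · rw [norm_zero]; exact zero_le_one
  have hc1 : c 1 = 1 := by
    have : ¬ ℓ ∣ 1 := fun h ↦ hℓ.ne_one (Nat.dvd_one.mp h)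
    simp only [hcdef, this, if_false, mul_zero, sub_zero, hA1]
  -- ### the old form `y = ι_1 f − ι(β) ι_ℓ f` on `Γ₁(Nℓ)` and its `q`-expansion `ι(c n)`
  have h1dvd : N * 1 ∣ N * ℓ := by rw [mul_one]; exact dvd_mul_right N ℓ
  have hℓdvd : N * ℓ ∣ N * ℓ := dvd_rfl
  set y₁ : CuspForm (Gamma1 (N * ℓ)) k₀ :=
    liftToGamma1 (N * ℓ) k₀ (iota N (N * ℓ) 1 k₀ h1dvd f) -
      (ι β) • liftToGamma1 (N * ℓ) k₀ (iota N (N * ℓ) ℓ k₀ hℓdvd f) with hy₁def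
  have hy₁ : ∀ n, cuspCoeff y₁ n = ι (c n) := by
    intro n
    rw [hy₁def, cuspCoeff_sub_gamma1, cuspCoeff_smul_gamma1]
    change (qExpansion 1 ⇑(liftToGamma1 (N * ℓ) k₀ (iota N (N * ℓ) 1 k₀ h1dvd f))).coeff n -
      ι β * (qExpansion 1 ⇑(liftToGamma1 (N * ℓ) k₀ (iota N (N * ℓ) ℓ k₀ hℓdvd f))).coeff n = _
    rw [coe_liftToGamma1_holds, coe_liftToGamma1_holds, qExpansion_coeff_iota, qExpansion_coeff_iota,
      if_pos (one_dvd n), Nat.div_one]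
    by_cases hℓn : ℓ ∣ n <;>
      simp only [hcdef, hAf, hℓn, if_true, if_false, map_sub, map_mul, mul_zero, sub_zero,
        RingEquiv.apply_symm_apply]
  -- ### the form `x = y · G ∈ S_{k₀+w}(Nℓ, 𝟙)`
  let x : CuspForm (Gamma1 (N * ℓ)) (k₀ + w) := y₁.mulModularForm G
  have hxq : qExpansion 1 ⇑x = qExpansion 1 ⇑y₁ * qExpansion 1 ⇑G := by
    change qExpansion 1 ⇑(y₁.mulModularForm G) = _
    rw [CuspForm.coe_mulModularForm]
    exact ModularForm.qExpansion_mul_coe one_pos h1L y₁ G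
  have hxmul : ∀ m, cuspCoeff x m = ∑ ij ∈ Finset.HasAntidiagonal.antidiagonal m,
      cuspCoeff y₁ ij.1 * (qExpansion 1 ⇑G).coeff ij.2 := fun m ↦ by
    change (qExpansion 1 ⇑x).coeff m = _
    rw [hxq, PowerSeries.coeff_mul]
    rfl
  -- `x ≡ c`: `‖ι⁻¹ a_m(x) - c m‖ < 1`, `‖ι⁻¹ a_m(x)‖ ≤ 1`, `a_1(x) ≡ 1`
  have hxc : ∀ m, ‖ι.symm (cuspCoeff x m) - c m‖ < 1 := by
    intro m
    have hmem : (m, 0) ∈ Finset.HasAntidiagonal.antidiagonal m := by simp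
    rw [hxmul, ← Finset.add_sum_erase _ _ hmem, hG0, mul_one, hy₁, map_add,
      RingEquiv.symm_apply_apply, add_sub_cancel_left, map_sum]
    refine norm_sum_lt_one₃ _ _ fun ij hij ↦ ?_
    obtain ⟨hne, hij'⟩ := Finset.mem_erase.mp hij
    have hj : ij.2 ≠ 0 := by
      intro h
      apply hne
      have := Finset.HasAntidiagonal.mem_antidiagonal.mp hij'
      rw [h, add_zero] at this
      exact Prod.ext this h
    rw [map_mul, hy₁, RingEquiv.symm_apply_apply]
    exact norm_mul_lt_one_of_le_of_lt (hcint _) (hGm _ hj)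
  set D : ℕ → PadicAlgCl p := fun m ↦ ι.symm (cuspCoeff x m) - c m with hD
  have hDlt : ∀ m, ‖D m‖ < 1 := hxc
  have hxD : ∀ m, ι.symm (cuspCoeff x m) = c m + D m := fun m ↦ by rw [hD]; ring
  have hxint : ∀ m, ‖ι.symm (cuspCoeff x m)‖ ≤ 1 := fun m ↦ by
    rw [hxD]
    exact (PadicAlgCl.isNonarchimedean p _ _).trans (max_le (hcint m) (hDlt m).le)
  have hx1 : ‖ι.symm (cuspCoeff x 1)‖ = 1 :=
    norm_eq_one_of_norm_sub_lt_one₃ (y := c 1) (by rw [hc1, norm_one]) (hxc 1)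
  -- trivial nebentypus
  have hxdiam : ∀ d : (ZMod (N * ℓ))ˣ, diamondOp (N * ℓ) (k₀ + w) (d : ZMod (N * ℓ)) x = x := by
    intro d
    change diamondOp (N * ℓ) (k₀ + (w : ℤ)) (d : ZMod (N * ℓ)) (y₁.mulModularForm G) = _
    rw [diamondOp_mulModularForm_of_forall_slash_eq G hGΓ (d : ZMod (N * ℓ)) y₁, hy₁def, map_sub,
      map_smul, diamondOp_liftToGamma1, diamondOp_liftToGamma1]
  have hxW : x ∈ nebentypusSubspace (N * ℓ) (k₀ + w) 1 := by
    rw [mem_nebentypusSubspace_iff_diamondOp]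
    intro d
    rw [MulChar.one_apply_coe, one_smul]
    exact hxdiam d
  -- ### Fermat: `q^{e₀+w} ≡ q^{e₀}`
  have hdvd : ∀ q : ℕ, q.Prime → (p : ℤ) ∣ ((q ^ (e₀ + w) : ℕ) : ℤ) - ((q ^ e₀ : ℕ) : ℤ) := by
    intro q hq
    have hfac : ((q ^ (e₀ + w) : ℕ) : ℤ) - ((q ^ e₀ : ℕ) : ℤ) =
        (q : ℤ) ^ e₀ * ((q : ℤ) ^ w - 1) := by push_cast; ring
    rw [hfac]
    by_cases hqp : q = p
    · subst hqp
      exact Dvd.dvd.mul_right (dvd_pow_self (q : ℤ) (by omega)) _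
    · apply Dvd.dvd.mul_left
      have hcop : IsCoprime (q : ℤ) p := by
        rw [Nat.isCoprime_iff_coprime]
        exact (Nat.coprime_primes hq hp).2 hqp
      obtain ⟨c', hc'⟩ := hpw
      have h1 : (q : ℤ) ^ (p - 1) ≡ 1 [ZMOD p] := Int.ModEq.pow_card_sub_one_eq_one hp hcop
      have h2 : (q : ℤ) ^ w ≡ 1 [ZMOD p] := by
        rw [hc', pow_mul]
        simpa using h1.pow c'
      exact (Int.ModEq.dvd h2.symm)
  have hpowdiff : ∀ q : ℕ, q.Prime →
      ‖ι.symm (((q ^ (e₀ + w) : ℕ) : ℂ)) - (q : PadicAlgCl p) ^ e₀‖ < 1 := by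
    intro q hq
    rw [map_natCast]
    have h := norm_intCast_lt_one_of_dvd₃ (hdvd q hq)
    push_cast at h ⊢
    exact h
  have hpownorm : ∀ q : ℕ, ‖ι.symm (((q ^ (e₀ + w) : ℕ) : ℂ))‖ ≤ 1 := fun q ↦ by
    rw [map_natCast, ← Int.cast_natCast]
    exact DeligneSerreLift.norm_intCast_le_one _
  -- ### `(B)` `x` is a mod-`𝔪` eigenvector of EVERY `T_q`: eigenvalue `α` at `ℓ`, `a_q(f)` elsewhere
  set A : ℕ → PadicAlgCl p := fun q ↦ if q = ℓ then α else Af q with hAdef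
  have hAint' : ∀ q, ‖A q‖ ≤ 1 := fun q ↦ by
    simp only [hAdef]
    split_ifs
    · exact hαle
    · exact hAint q
  have hcongT : ∀ (q : ℕ) (hq : q.Prime) (n : ℕ),
      ‖ι.symm (cuspCoeff ((haveI : NeZero q := ⟨hq.ne_zero⟩;
          heckeT (Gamma1 (N * ℓ)) (k₀ + w) q) x) n) - A q * ι.symm (cuspCoeff x n)‖ < 1 := by
    intro q hq n
    haveI : NeZero q := ⟨hq.ne_zero⟩
    have hTx := cuspCoeff_heckeT_gamma1 x q hq n
    by_cases hqℓ : q = ℓ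
    · -- `U_ℓ`: `a_n(U_ℓ x) = a_{ℓn}(x)`, `c(ℓn) = α c(n)`
      subst hqℓ
      rw [if_pos (dvd_mul_left q N), add_zero] at hTx
      have hAq : A q = α := by simp [hAdef]
      have e1 : ι.symm (cuspCoeff (heckeT (Gamma1 (N * q)) (k₀ + ↑w) q x) n) -
          A q * ι.symm (cuspCoeff x n) = D (q * n) - α * D n := by
        rw [hTx, hxD, hxD n, hAq, hrec_ℓ n]
        ring
      rw [e1]
      refine (norm_sub_le_max₃ _ _).trans_lt (max_lt (hDlt _) ?_)
      exact norm_mul_lt_one_of_le_of_lt hαle (hDlt n)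
    · have hAq : A q = Af q := by simp [hAdef, hqℓ]
      rw [hAq]
      by_cases hqL : q ∣ N * ℓ
      · rw [if_pos hqL, add_zero] at hTx
        have e1 : ι.symm (cuspCoeff (heckeT (Gamma1 (N * ℓ)) (k₀ + ↑w) q x) n) -
            Af q * ι.symm (cuspCoeff x n) = D (q * n) - Af q * D n := by
          rw [hTx, hxD, hxD n, hrec_c q hq hqℓ n, if_pos hqL]
          ring
        rw [e1]
        refine (norm_sub_le_max₃ _ _).trans_lt (max_lt (hDlt _) ?_)
        exact norm_mul_lt_one_of_le_of_lt (hAint q) (hDlt n)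
      · rw [if_neg hqL] at hTx
        obtain ⟨d, hd⟩ := (ZMod.isUnit_prime_iff_not_dvd hq).mpr hqL
        have hdiag : diamondOp (N * ℓ) (k₀ + w) (q : ZMod (N * ℓ)) x = x := by
          rw [← hd]; exact hxdiam d
        rw [hdiag, hzpow q] at hTx
        by_cases hqn : q ∣ n
        · rw [if_pos hqn] at hTx
          have e1 : ι.symm (cuspCoeff (heckeT (Gamma1 (N * ℓ)) (k₀ + ↑w) q x) n) -
              Af q * ι.symm (cuspCoeff x n) =
              D (q * n) - Af q * D n +
                (ι.symm (((q ^ (e₀ + w) : ℕ) : ℂ)) * D (n / q) +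
                  (ι.symm (((q ^ (e₀ + w) : ℕ) : ℂ)) - (q : PadicAlgCl p) ^ e₀) * c (n / q)) := by
            rw [hTx, map_add, map_mul, hxD, hxD n, hxD (n / q), hrec_c q hq hqℓ n, if_neg hqL,
              if_pos hqn]
            ring
          rw [e1]
          refine (PadicAlgCl.isNonarchimedean p _ _).trans_lt (max_lt ?_ ?_)
          · refine (norm_sub_le_max₃ _ _).trans_lt (max_lt (hDlt _) ?_)
            exact norm_mul_lt_one_of_le_of_lt (hAint q) (hDlt n)
          · refine (PadicAlgCl.isNonarchimedean p _ _).trans_lt (max_lt ?_ ?_)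
            · exact norm_mul_lt_one_of_le_of_lt (hpownorm q) (hDlt _)
            · rw [norm_mul]
              exact mul_lt_one_of_nonneg_of_lt_one_left (norm_nonneg _) (hpowdiff q hq)
                (hcint _)
        · rw [if_neg hqn, mul_zero, add_zero] at hTx
          have e1 : ι.symm (cuspCoeff (heckeT (Gamma1 (N * ℓ)) (k₀ + ↑w) q x) n) -
              Af q * ι.symm (cuspCoeff x n) = D (q * n) - Af q * D n := by
            rw [hTx, hxD, hxD n, hrec_c q hq hqℓ n, if_neg hqL, if_neg hqn, mul_zero, sub_zero]
            ring
          rw [e1]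
          refine (norm_sub_le_max₃ _ _).trans_lt (max_lt (hDlt _) ?_)
          exact norm_mul_lt_one_of_le_of_lt (hAint q) (hDlt n)
  -- ### `(C)+(D)` the pipeline
  obtain ⟨M, _, hML, g, F, u, hgnew, hF0, hTF, hua, hga, hspan⟩ :=
    exists_isNewform0_eigenform_of_modEigenform ι hK1 hxW hxint hx1 A hAint' hcongT
  have huα : ‖ι.symm (u ℓ) - α‖ < 1 := by simpa [hAdef] using hua ℓ hℓ
  have hα : α ^ 2 - Af ℓ * α + (ℓ : PadicAlgCl p) ^ e₀ = 0 := by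
    rw [← hαβ, ← hαβ']; ring
  have hdich := hgnew.dvd_or_dvd_of_mem_span_auxPrime hℓ hℓN hML hF0 hspan (hTF ℓ hℓ)
  refine ⟨M, inferInstance, hML, g, hgnew, fun q hq hqL ↦ ?_, fun hℓM ↦ ?_, fun hℓM ↦ ?_⟩
  · -- congruence off `Nℓ`
    have hqℓ : q ≠ ℓ := fun h ↦ hqL (h ▸ dvd_mul_left ℓ N)
    have h := hua q hq
    rw [← hga q hq hqL] at h
    simpa [hAdef, hqℓ, hAf] using h
  · -- the `ℓ`-new case: Ribet's congruence
    rcases hdich with ⟨hMN, -⟩ | ⟨-, -, hu2⟩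
    · exact absurd (hℓM.trans hMN) hℓN
    · have hu' : ι.symm (u ℓ) ^ 2 = (ℓ : PadicAlgCl p) ^ (e₀ + w - 1) := by
        rw [← map_pow, hu2, show k₀ + (w : ℤ) - 2 = ((e₀ + w - 1 : ℕ) : ℤ) by omega, zpow_natCast,
          map_pow, map_natCast]
      have h := norm_sq_sub_levelRaising_lt_one hpℓ hpw he₀1 (hAint ℓ) hα huα hu'
      rwa [show (k₀ - 2).toNat = e₀ - 1 by omega]
  · -- the `ℓ`-old case: the congruence at `ℓ` itself
    rcases hdich with ⟨-, hu1⟩ | ⟨hℓM', -, -⟩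
    · have hag : ‖ι.symm ((qExpansion 1 ⇑g).coeff ℓ)‖ ≤ 1 :=
        norm_le_one_of_isIntegral₃ ((IsNewform0.isIntegral_coeff_holds hgnew ℓ).map
          (ι.symm : ℂ →+* PadicAlgCl p).toIntAlgHom)
      have hu' : ι.symm (u ℓ) ^ 2 - ι.symm ((qExpansion 1 ⇑g).coeff ℓ) * ι.symm (u ℓ) +
          (ℓ : PadicAlgCl p) ^ (e₀ + w) = 0 := by
        have h := congrArg ι.symm hu1
        rw [show k₀ + (w : ℤ) - 1 = ((e₀ + w : ℕ) : ℤ) by push_cast; omega, zpow_natCast] at h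
        simpa [map_sub, map_add, map_mul, map_pow, map_natCast] using h
      exact norm_sub_lt_one_of_oldRelation hpℓ hpw hag hαle hβle hα hαβ' huα hu'
    · exact absurd hℓM' hℓM

/-- **Descent to level `N`**: in the situation of
`exists_isNewform0_dvd_level_congr_of_multiplier_auxPrime`, if `a_ℓ(f)² ≢ ℓ^{k₀-2}(ℓ+1)² (mod 𝔪)`
(`‖ι⁻¹a_ℓ(f)² − ℓ^{k₀−2}(ℓ+1)²‖ = 1`; the congruence class in which `ρ̄_f` could be `ℓ`-new is
avoided), the congruent newform of weight `k₀ + w` has level `M ∣ N` and is congruent to `f` at EVERY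
prime `q ∤ N`, the auxiliary prime `ℓ` included.
[cite: Ribet1984ICM, Thm. 1 (necessity of the congruence)] [cite: DeligneSerreASENS1974, Lemme 6.11] -/
theorem exists_isNewform0_dvd_level_congr_of_multiplier_auxPrime_of_norm_eq_one
    (ι : PadicAlgCl p ≃+* ℂ) {N ℓ : ℕ} [NeZero N] [NeZero (N * ℓ)] (hℓ : ℓ.Prime) (hℓN : ¬ ℓ ∣ N)
    (hpℓ : ¬ p ∣ ℓ) {k₀ : ℤ} (hk₀ : 2 ≤ k₀) {f : CuspForm (Gamma0 N) k₀} (hf : IsNewform0 f)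
    (hR : ‖ι.symm ((qExpansion 1 ⇑f).coeff ℓ) ^ 2 -
        (ℓ : PadicAlgCl p) ^ (k₀ - 2).toNat * ((ℓ : PadicAlgCl p) + 1) ^ 2‖ = 1)
    {w : ℕ} (hpw : (p - 1) ∣ w) {k₁ : ℤ} (hk₁ : k₁ = w) (G : ModularForm (Gamma1 (N * ℓ)) k₁)
    (hGΓ : ∀ γ : SL(2, ℤ), γ ∈ Gamma0 (N * ℓ) → (⇑G : ℍ → ℂ) ∣[k₁] γ = ⇑G)
    (hG0 : (qExpansion 1 ⇑G).coeff 0 = 1)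
    (hGm : ∀ j : ℕ, j ≠ 0 → ‖ι.symm ((qExpansion 1 ⇑G).coeff j)‖ < 1) :
    ∃ (M : ℕ) (_ : NeZero M) (_ : M ∣ N) (g : CuspForm (Gamma0 M) (k₀ + k₁)),
      IsNewform0 g ∧
      ∀ q : ℕ, q.Prime → ¬ q ∣ N →
        ‖ι.symm ((qExpansion 1 ⇑g).coeff q) - ι.symm ((qExpansion 1 ⇑f).coeff q)‖ < 1 := by
  obtain ⟨M, _, hML, g, hg, hcong, hR', hold⟩ :=
    exists_isNewform0_dvd_level_congr_of_multiplier_auxPrime ι hℓ hℓN hpℓ hk₀ hf hpw hk₁ G hGΓ hG0 hGm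
  have hℓM : ¬ ℓ ∣ M := fun h ↦ by
    have := hR' h
    rw [hR] at this
    exact lt_irrefl _ this
  refine ⟨M, inferInstance, Nat.Coprime.dvd_of_dvd_mul_right
    (Nat.coprime_comm.mp ((Nat.Prime.coprime_iff_not_dvd hℓ).mpr hℓM)) hML, g, hg, fun q hq hqN ↦ ?_⟩
  by_cases hqℓ : q = ℓ
  · subst hqℓ
    exact hold hℓM
  · refine hcong q hq fun h ↦ ?_
    rcases (Nat.Prime.dvd_mul hq).mp h with h' | h'
    · exact hqN h'
    · exact hqℓ ((Nat.prime_dvd_prime_iff_eq hq hℓ).mp h')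

end Main

/-! ### §6 Mazur's multiplier `E₂^{(M)}/(1 − M)` as an object, and the corollaries at `p = 3`, `p = 2` -/

section Mazur

variable {p : ℕ} [Fact p.Prime]

open scoped ArithmeticFunction.sigma in
/-- **Mazur's weight-`2` Eisenstein series as a Deligne–Serre multiplier.**  For a prime `M ∣ N'` with
`‖24/(1 − M)‖_p < 1` there is `G ∈ M₂(Γ₁(N'))`, invariant under `Γ₀(N')`, with `a₀(G) = 1` and
`‖ι⁻¹aⱼ(G)‖ < 1` for `j ≥ 1`: `G = E₂^{(M)}/(1 − M)`, `E₂^{(M)}(z) = E₂(z) − M E₂(Mz)` (the tree's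
`mazurEisensteinMF`, `qExpansion_coeff_mazurEisensteinMF`).  The construction is the one inlined in
`exists_isNewform0_dvd_level_congr_of_mazurMultiplier`, exposed here as an object.
[cite: DiamondShurman2005, §1.2 (E₂(τ) − N E₂(Nτ) ∈ M₂(Γ₀(N)))] -/
theorem exists_mazurMultiplier (ι : PadicAlgCl p ≃+* ℂ) {N' M : ℕ} [NeZero N'] (hM : M.Prime)
    (hMN' : M ∣ N') (h24 : ‖(24 : PadicAlgCl p) / (1 - (M : PadicAlgCl p))‖ < 1) :
    ∃ G : ModularForm (Gamma1 N') 2,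
      (∀ γ : SL(2, ℤ), γ ∈ Gamma0 N' → (⇑G : ℍ → ℂ) ∣[(2 : ℤ)] γ = ⇑G) ∧
      (qExpansion 1 ⇑G).coeff 0 = 1 ∧
      (∀ j : ℕ, j ≠ 0 → ‖ι.symm ((qExpansion 1 ⇑G).coeff j)‖ < 1) := by
  classical
  haveI : NeZero M := ⟨hM.ne_zero⟩
  have hΓ : ∀ γ : SL(2, ℤ), γ ∈ Gamma0 N' → γ ∈ Gamma0 M := by
    intro γ hγ
    rw [Gamma0_mem] at hγ ⊢
    rw [ZMod.intCast_zmod_eq_zero_iff_dvd] at hγ ⊢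
    exact (Int.natCast_dvd_natCast.mpr hMN').trans hγ
  have hM1 : (1 : ℂ) - (M : ℂ) ≠ 0 := by
    have h2 : (2 : ℝ) ≤ (M : ℝ) := by exact_mod_cast hM.two_le
    intro h
    have h' : ((1 : ℝ) - (M : ℝ) : ℂ) = 0 := by push_cast; exact h
    have h'' : (1 : ℝ) - (M : ℝ) = 0 := by exact_mod_cast h'
    linarith
  set c : ℂ := (1 - (M : ℂ))⁻¹ with hc
  let F : ModularForm (Gamma1 N') 2 :=
    { toFun := mazurE2 M
      slash_action_eq' := fun A hA ↦ by
        obtain ⟨A, (hA : A ∈ Gamma1 N'), rfl⟩ := hA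
        exact mazurE2_slash_of_mem_gamma0 M (hΓ A (Gamma1_in_Gamma0 N' hA))
      holo' := (mazurEisensteinMF M hM).holo'
      bdd_at_cusps' := fun {cusp} hcusp ↦ by
        rw [Subgroup.IsArithmetic.isCusp_iff_isCusp_SL2Z] at hcusp
        rw [OnePoint.isBoundedAt_iff_forall_SL2Z hcusp]
        intro γ _
        exact isBoundedAtImInfty_mazurE2_slash M hM γ }
  have hFcoe : (⇑F : ℍ → ℂ) = ⇑(mazurEisensteinMF M hM) := rfl
  let G : ModularForm (Gamma1 N') 2 := c • F
  have hGcoe : (⇑G : ℍ → ℂ) = c • ⇑(mazurEisensteinMF M hM) := by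
    rw [← hFcoe]; exact ModularForm.IsGLPos.coe_smul F c
  have hGq : ∀ n, (qExpansion 1 ⇑G).coeff n =
      c * (qExpansion 1 ⇑(mazurEisensteinMF M hM)).coeff n := fun n ↦ by
    rw [hGcoe, qExpansion_smul (ModularFormClass.analyticAt_cuspFunction_zero
      (mazurEisensteinMF M hM) one_pos (HeckeTGamma1.one_mem_strictPeriods_Gamma1 M)) c]
    simp
  refine ⟨G, fun γ hγ ↦ ?_, ?_, fun j hj ↦ ?_⟩
  · rw [hGcoe, ModularForm.SL_smul_slash, mazurEisensteinMF_slash_of_mem_gamma0 M hM (hΓ γ hγ)]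
  · rw [hGq, qExpansion_coeff_mazurEisensteinMF, if_pos rfl, hc, inv_mul_cancel₀ hM1]
  · rw [hGq, qExpansion_coeff_mazurEisensteinMF, if_neg hj]
    obtain ⟨Z, hZ⟩ : ∃ Z : ℤ, ((σ 1 j : ℂ) - (M : ℂ) * (if M ∣ j then (σ 1 (j / M) : ℂ) else 0)) =
        (Z : ℂ) := by
      by_cases hMj : M ∣ j
      · exact ⟨(σ 1 j : ℤ) - M * σ 1 (j / M), by rw [if_pos hMj]; push_cast; ring⟩
      · exact ⟨σ 1 j, by rw [if_neg hMj]; push_cast; ring⟩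
    rw [hZ, hc, show (1 - (M : ℂ))⁻¹ * (-24 * (Z : ℂ)) = (24 : ℂ) / (1 - (M : ℂ)) * (-(Z : ℂ)) by
      field_simp, map_mul, map_neg, map_intCast, map_div₀, map_sub, map_one, map_natCast,
      map_ofNat, norm_mul, norm_neg]
    exact mul_lt_one_of_nonneg_of_lt_one_left (norm_nonneg _) h24
      (DeligneSerreLift.norm_intCast_le_one Z)

/-- `‖24/(1 − ℓ)‖₃ < 1` for `3 ∤ ℓ − 1`. [folklore] -/
private theorem norm_twentyFour_div_lt_one_three' [Fact (3 : ℕ).Prime] {M : ℕ}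
    (hM : ¬ (3 : ℤ) ∣ (M : ℤ) - 1) :
    ‖(24 : PadicAlgCl 3) / (1 - (M : PadicAlgCl 3))‖ < 1 := by
  have h24 : ‖(24 : PadicAlgCl 3)‖ < 1 := by
    have h := norm_intCast_lt_one_of_dvd₃ (p := 3) (z := 24) ⟨8, by norm_num⟩
    exact_mod_cast h
  have hden : ‖(1 : PadicAlgCl 3) - (M : PadicAlgCl 3)‖ = 1 := by
    have h := DeligneSerreLift.norm_intCast_eq_one_of_not_dvd (p := 3) (z := 1 - (M : ℤ))
      (fun h ↦ hM (by have := h.neg_right; simpa using this))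
    push_cast at h
    exact h
  rw [norm_div, hden, div_one]
  exact h24

/-- **At `p = 3`: a congruent newform of weight `k₀ + 2` and level dividing `N`, for EVERY newform with
one good prime `ℓ ≡ 2 (mod 3)` at which `a_ℓ` is a `3`-adic unit.**  Let `f ∈ S_{k₀}(Γ₀(N))` be a
newform, `k₀ ≥ 2`, `ι : ℚ̄₃ ≃ ℂ`, and `ℓ ∤ N` a prime with `ℓ ≡ 2 (mod 3)` and `‖ι⁻¹a_ℓ(f)‖₃ = 1`.  Then
there are `M ∣ N` and a newform `g ∈ S_{k₀+2}(Γ₀(M))` with `‖ι⁻¹a_q(g) − ι⁻¹a_q(f)‖₃ < 1` for every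
prime `q ∤ N`.  Multiplier: Mazur's `E₂^{(ℓ)}/(1 − ℓ) ≡ 1 (mod 3)` at level `Nℓ`
(`exists_mazurMultiplier`); descent: Ribet's class is `a_ℓ² ≡ ℓ^{k₀−2}(ℓ+1)² ≡ 0 (mod 3)`, excluded by
`a_ℓ` being a unit (`exists_isNewform0_dvd_level_congr_of_multiplier_auxPrime_of_norm_eq_one`).  This
removes the residue «every prime factor of `N` is `≡ 1 (mod 3)`» of
`DeligneSerreCompanionAuxiliaryLevelProofs` whenever such an `ℓ` exists (no Katz lift of the Hasse
invariant is used). [cite: DeligneSerreASENS1974, Lemme 6.11] [cite: Ribet1984ICM, Thm. 1 (necessity of the congruence)]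
[cite: DiamondShurman2005, §1.2, Prop. 5.6.2 and Thm. 5.8.3] -/
theorem exists_isNewform0_dvd_level_congr_weight_add_two_three_of_auxPrime [Fact (3 : ℕ).Prime]
    (ι : PadicAlgCl 3 ≃+* ℂ) {N ℓ : ℕ} [NeZero N] (hℓ : ℓ.Prime) (hℓN : ¬ ℓ ∣ N) (hℓ3 : ℓ % 3 = 2)
    {k₀ : ℤ} (hk₀ : 2 ≤ k₀) {f : CuspForm (Gamma0 N) k₀} (hf : IsNewform0 f)
    (hunit : ‖ι.symm ((qExpansion 1 ⇑f).coeff ℓ)‖ = 1) :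
    ∃ (M : ℕ) (_ : NeZero M) (_ : M ∣ N) (g : CuspForm (Gamma0 M) (k₀ + 2)),
      IsNewform0 g ∧
      ∀ q : ℕ, q.Prime → ¬ q ∣ N →
        ‖ι.symm ((qExpansion 1 ⇑g).coeff q) - ι.symm ((qExpansion 1 ⇑f).coeff q)‖ < 1 := by
  haveI : NeZero (N * ℓ) := ⟨mul_ne_zero (NeZero.ne N) hℓ.ne_zero⟩
  have h3ℓ : ¬ 3 ∣ ℓ := by omega
  have hℓ1 : ¬ (3 : ℤ) ∣ (ℓ : ℤ) - 1 := by omega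
  obtain ⟨G, hGΓ, hG0, hGm⟩ :=
    exists_mazurMultiplier ι hℓ (dvd_mul_left ℓ N) (norm_twentyFour_div_lt_one_three' hℓ1)
  -- Ribet's class is `0 (mod 3)`: `(ℓ + 1)² ≡ 0`, while `a_ℓ²` is a unit
  have hℓp1 : ‖(ℓ : PadicAlgCl 3) + 1‖ < 1 := by
    have h := norm_intCast_lt_one_of_dvd₃ (p := 3) (z := (ℓ : ℤ) + 1) (by omega)
    push_cast at h
    exact h
  have hsmall : ‖(ℓ : PadicAlgCl 3) ^ (k₀ - 2).toNat * ((ℓ : PadicAlgCl 3) + 1) ^ 2‖ < 1 := by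
    rw [norm_mul, norm_pow, norm_pow]
    refine mul_lt_one_of_nonneg_of_lt_one_right (pow_le_one₀ (norm_nonneg _) ?_)
      (pow_nonneg (norm_nonneg _) 2) ?_
    · have h := DeligneSerreLift.norm_intCast_le_one (p := 3) (ℓ : ℤ)
      simpa using h
    · exact pow_lt_one₀ (norm_nonneg _) hℓp1 two_ne_zero
  have hR : ‖ι.symm ((qExpansion 1 ⇑f).coeff ℓ) ^ 2 -
      (ℓ : PadicAlgCl 3) ^ (k₀ - 2).toNat * ((ℓ : PadicAlgCl 3) + 1) ^ 2‖ = 1 := by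
    refine norm_eq_one_of_norm_sub_lt_one₃ (y := ι.symm ((qExpansion 1 ⇑f).coeff ℓ) ^ 2)
      (by rw [norm_pow, hunit, one_pow]) ?_
    rwa [sub_sub_cancel_left, norm_neg]
  exact exists_isNewform0_dvd_level_congr_of_multiplier_auxPrime_of_norm_eq_one ι hℓ hℓN h3ℓ hk₀ hf hR
    (by norm_num) (show (2 : ℤ) = ((2 : ℕ) : ℤ) by norm_num) G hGΓ hG0 hGm

end Mazur

end Literature.NumberTheory.EllipticCurves.ModularForms

end
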